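import Literature.NumberTheory.GaloisRepresentations.CliffordInducedPrimeIndexConj
import HarnessLib

/-!
# Clifford–Tate structure, induced branch (frame level): a system of imprimitivity along an open
# subgroup gives an explicit conjugacy to the induced block matrix

Abstract ("framed") half of the induced branch of the Clifford–Tate structure theorem
(`Summit.Langlands.Langlands.Theses.MonodromyDichotomy.CliffordTateStructure`).  For an irreducible
framed `r : G →ₜ* GL_n(A)`, an injective `φ : H →ₜ* G` with image `N`, a subspace `U ≤ Aⁿ` from
which `r` is INDUCED (a system of imprimitivity with stabiliser `N`: `r(g)U = U ↔ g ∈ N`, the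
translates `r(g)U` are independent and span; Zarhin's `IsInducedFrom`, spelled out) and ANY
transversal `t` of `G / N`, there are an
irreducible framed `s : H →ₜ* GL_m(A)` (`m = dim U`), `Q ∈ GL_n(A)` and a relabelling `e` with
`Q r(x) Q⁻¹ = reindex e e (Ind(s)(x))` — the matrix form `r ≅ Ind_N^G U` (Serre §3.3 Thm. 12, §7.1;
Clifford 1937 Thm. 1), obtained exactly as in the prime-index file
`CliffordInducedPrimeIndexConj` but with the decomposition `V = ⊕ᵢ r(tᵢ) U` supplied by
the system of imprimitivity instead of the eigenspaces of a twist intertwiner.  Also: the system is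
transported along conjugation of the subgroup (`stabiliser_translate`, `range_map_translate`).
[cite: SerreLinearRepresentations1977, §3.3 Thm. 12 (proof), §7.1] [cite: Clifford1937, Thm. 1]
[cite: Zarhin2005Clifford, §3 Example 3.4]
-/

set_option autoImplicit false
set_option linter.dupNamespace false

noncomputable section

namespace Summit.Langlands.Langlands.Theorems

open Literature.NumberTheory.GaloisRepresentations

/-! ### Systems of imprimitivity: elementary consequences of the stabiliser condition -/

section Stabiliser

variable {k : Type*} [Field k] {G : Type*} [Group G] {V : Type*} [AddCommGroup V] [Module k V]
  {ρ : Representation k G V} {H : Subgroup G} {W : Submodule k V}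

/-- `ρ(x) W = ρ(y) W ↔ x⁻¹ y ∈ H`, from the stabiliser condition `ρ(g) W = W ↔ g ∈ H`. [folklore] -/
theorem map_eq_map_iff_of_stabiliser (hstab : ∀ g : G, W.map (ρ g) = W ↔ g ∈ H) (x y : G) :
    W.map (ρ x) = W.map (ρ y) ↔ x⁻¹ * y ∈ H := by
  rw [← hstab (x⁻¹ * y)]
  constructor
  · intro h
    have h1 := congrArg (Submodule.map (ρ x⁻¹)) h
    simp only [← Submodule.map_comp, ← Module.End.mul_eq_comp, ← map_mul, inv_mul_cancel, map_one,
      Module.End.one_eq_id, Submodule.map_id] at h1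
    exact h1.symm
  · intro h
    have h1 := congrArg (Submodule.map (ρ x)) h
    simp only [← Submodule.map_comp, ← Module.End.mul_eq_comp, ← map_mul, mul_inv_cancel_left] at h1
    exact h1.symm

/-- Elements of the stabiliser map `W` into itself. [folklore] -/
theorem apply_mem_of_stabiliser (hstab : ∀ g : G, W.map (ρ g) = W ↔ g ∈ H) {h : G} (hh : h ∈ H)
    {v : V} (hv : v ∈ W) : ρ h v ∈ W := by
  rw [← (hstab h).2 hh]
  exact Submodule.mem_map_of_mem hv

/-- **Transport of a system of imprimitivity along a conjugation of the subgroup**: if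
`ρ(γ) W = W ↔ γ ∈ H` and `H' = g H g⁻¹` (given as `γ ∈ H' ↔ g⁻¹ γ g ∈ H`), then
`ρ(γ) (ρ(g) W) = ρ(g) W ↔ γ ∈ H'`, and the set of translates of `ρ(g) W` is that of `W`. [folklore] -/
theorem stabiliser_translate (hstab : ∀ γ : G, W.map (ρ γ) = W ↔ γ ∈ H) (H' : Subgroup G) (g : G)
    (hH' : ∀ γ : G, γ ∈ H' ↔ g⁻¹ * γ * g ∈ H) (x : G) :
    (W.map (ρ g)).map (ρ x) = W.map (ρ g) ↔ x ∈ H' := by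
  rw [← Submodule.map_comp, ← Module.End.mul_eq_comp, ← map_mul, hH' x,
    map_eq_map_iff_of_stabiliser hstab (x * g) g, show (x * g)⁻¹ * g = (g⁻¹ * x * g)⁻¹ by group,
    inv_mem_iff]

/-- The translates of `ρ(g) W` are the translates of `W`. [folklore] -/
theorem range_map_translate (g : G) :
    Set.range (fun x : G => (W.map (ρ g)).map (ρ x)) = Set.range (fun x : G => W.map (ρ x)) := by
  ext U
  constructor
  · rintro ⟨x, rfl⟩
    refine ⟨x * g, ?_⟩
    change W.map (ρ (x * g)) = (W.map (ρ g)).map (ρ x)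
    rw [map_mul, Module.End.mul_eq_comp, Submodule.map_comp]
  · rintro ⟨y, rfl⟩
    refine ⟨y * g⁻¹, ?_⟩
    change (W.map (ρ g)).map (ρ (y * g⁻¹)) = W.map (ρ y)
    rw [← Submodule.map_comp, ← Module.End.mul_eq_comp, ← map_mul, inv_mul_cancel_right]

/-- The sum of the translates of `ρ(g) W` is the sum of the translates of `W`. [folklore] -/
theorem iSup_map_translate (g : G) :
    ⨆ x : G, (W.map (ρ g)).map (ρ x) = ⨆ x : G, W.map (ρ x) := by
  rw [← sSup_range, ← sSup_range, range_map_translate]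

end Stabiliser

/-! ### Induced from `(N, U)` ⟹ conjugate to the induced block matrix -/

section Framed

universe u u' v

variable {G : Type u} {H : Type u'} [Group G] [TopologicalSpace G] [Group H] [TopologicalSpace H]
  [IsTopologicalGroup H] {A : Type v} [Field A] [TopologicalSpace A] [IsTopologicalRing A] {n : ℕ}

/-- **Clifford theory, "induced" form ⟹ explicit conjugacy to the induced matrix.**  Let
`r : G →ₜ* GL_n(A)` be an irreducible framed representation, `φ : H →ₜ* G` injective with image
`N`, `U ≤ Aⁿ` a non-zero subspace with `r(g) U = U ↔ g ∈ N` whose translates `r(g) U` are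
independent and span (a system of imprimitivity with stabiliser `N`), and `t : ι → G` ANY
transversal of `G / N`.  Then there are an
IRREDUCIBLE framed `s : H →ₜ* GL_m(A)` with `m = dim U`, `Q ∈ GL_n(A)` and `e : ι × Fin m ≃ Fin n`
with `Q r(x) Q⁻¹ = reindex e e (Ind(s)(x))` for all `x` (`indMatrix`, flattened by `Matrix.comp`):
`s` is the frame of the `N`-representation on `U`, `Q` the change of basis to
`B (i, a) = r(tᵢ) u_a`; irreducibility of `U` by `isIrreducible_toRepresentation_of_iSupIndep`.
[cite: SerreLinearRepresentations1977, §3.3 Thm. 12 (proof), §7.1] [cite: Clifford1937, Thm. 1] -/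
theorem exists_conj_eq_reindex_comp_indMatrix_of_isInducedFrom
    (r : FramedRep G A n) (hirr : r.IsIrreducible) (φ : H →ₜ* G) (hinj : Function.Injective φ)
    (U : Submodule A (Fin n → A)) (hUb : U ≠ ⊥)
    (hstab : ∀ g : G, U.map (r.toRepresentation g) = U ↔ g ∈ φ.toMonoidHom.range)
    (hind : sSupIndep (Set.range fun g : G => U.map (r.toRepresentation g)))
    (hsup : ⨆ g : G, U.map (r.toRepresentation g) = ⊤)
    {ι : Type*} [Fintype ι] [DecidableEq ι] (t : ι → G)
    (ht : Function.Bijective fun i => (t i : G ⧸ φ.toMonoidHom.range)) :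
    ∃ (s : FramedRep H A (Module.finrank A U)) (Q : GL (Fin n) A)
      (e : ι × Fin (Module.finrank A U) ≃ Fin n),
      s.IsIrreducible ∧ ∀ x : G,
        ((FramedRep.conj Q r x : GL (Fin n) A) : Matrix (Fin n) (Fin n) A) =
          Matrix.reindex e e (Matrix.comp ι ι (Fin (Module.finrank A U)) (Fin (Module.finrank A U)) A
            (indMatrix φ.toMonoidHom (FramedRep.toMatrixHom s) t x)) := by
  classical
  set ρ := r.toRepresentation with hρdef
  set N : Subgroup G := φ.toMonoidHom.range with hNdef
  have hinj' : Function.Injective φ.toMonoidHom := hinj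
  have hn : 0 < n := hirr.rank_pos
  haveI : Nonempty (Fin n) := ⟨⟨0, hn⟩⟩
  haveI : Nontrivial (Fin n → A) := inferInstance
  -- the sub-`H`-representation `U`
  let W : Subrepresentation (ρ.comp φ.toMonoidHom) :=
    ⟨U, fun h v hv => apply_mem_of_stabiliser hstab ⟨h, rfl⟩ hv⟩
  have hUW : U = W.toSubmodule := rfl
  have hWb : W ≠ ⊥ := fun h => hUb (congrArg Subrepresentation.toSubmodule h)
  have hHU : ∀ (h : H), ∀ v ∈ U, ρ (φ h) v ∈ U := fun h v hv => W.apply_mem_toSubmodule h hv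
  -- the index `i₁` of the trivial coset
  obtain ⟨i₁, hi₁⟩ := ht.2 ((1 : G) : G ⧸ N)
  have hti₁ : t i₁ ∈ N := by
    have h1 : (t i₁)⁻¹ * 1 ∈ N := QuotientGroup.eq.mp hi₁
    rw [mul_one] at h1
    exact inv_mem_iff.mp h1
  -- the family of translates `F i = ρ (t i) U`: independent and spanning
  set F : ι → Submodule A (Fin n → A) := fun i => U.map (ρ (t i)) with hFdef
  have hFi₁ : F i₁ = U := (hstab (t i₁)).2 hti₁
  have hinjF : Function.Injective F := by
    intro i j hij
    apply ht.1
    change (t i : G ⧸ N) = (t j : G ⧸ N)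
    rw [QuotientGroup.eq]
    exact (map_eq_map_iff_of_stabiliser hstab (t i) (t j)).1 hij
  have hF : iSupIndep F := by
    have h1 : iSupIndep
        (Subtype.val : Set.range (fun g : G => U.map (ρ g)) → Submodule A (Fin n → A)) :=
      (sSupIndep_iff _).1 hind
    let ι' : ι → Set.range (fun g : G => U.map (ρ g)) := fun i => ⟨F i, t i, rfl⟩
    have hι' : Function.Injective ι' := fun i j hij => hinjF (congrArg Subtype.val hij)
    exact h1.comp hι'
  have hFsup : ⨆ i, F i = ⊤ := by
    rw [eq_top_iff, ← hsup, iSup_le_iff]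
    intro g
    obtain ⟨i, hi⟩ := ht.2 (g : G ⧸ N)
    have h1 : U.map (ρ g) = F i :=
      (map_eq_map_iff_of_stabiliser hstab g (t i)).2 (QuotientGroup.eq.1 hi.symm)
    rw [h1]
    exact le_iSup F i
  have hint : DirectSum.IsInternal F :=
    DirectSum.isInternal_submodule_of_iSupIndep_of_iSup_eq_top hF hFsup
  -- the `H`-representation on `U`, continuous for the subspace (= module) topology, and its frame
  haveI : IsModuleTopology A U := TwistedSum.isModuleTopology_submodule_pi U
  let σU : ContinuousRep H A U := ⟨W.toRepresentation, by
    rw [Topology.IsInducing.subtypeVal.continuous_iff]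
    change Continuous fun q : H × U =>
      ((r (φ q.1) : GL (Fin n) A) : Matrix (Fin n) (Fin n) A).mulVec (q.2 : Fin n → A)
    exact ((Units.continuous_val.comp ((map_continuous r).comp
      ((map_continuous φ).comp continuous_fst))).matrix_mulVec
      (continuous_subtype_val.comp continuous_snd))⟩
  set m := Module.finrank A U with hmdef
  let bU : Module.Basis (Fin m) A U := Module.finBasis A U
  let s : FramedRep H A m := σU.frame bU
  have hs_coe : ∀ h : H, ((s h : GL (Fin m) A) : Matrix (Fin m) (Fin m) A) =
      LinearMap.toMatrix bU bU (W.toRepresentation h) := fun h => rfl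
  -- the adapted basis `B (i, a) = ρ (t i) (bU a)` of `V = ⊕ᵢ F i`, relabelled by `e`
  let eU : ∀ i : ι, U ≃ₗ[A] F i := fun i =>
    Submodule.equivMapOfInjective (ρ (t i))
      (Literature.RepresentationTheory.Semisimple.rep_apply_injective ρ (t i)) U
  let B : Module.Basis (ι × Fin m) A (Fin n → A) :=
    (hint.collectedBasis fun i => bU.map (eU i)).reindex (Equiv.sigmaEquivProd ι (Fin m))
  have hB : ∀ (i : ι) (a : Fin m), B (i, a) = ρ (t i) (bU a : Fin n → A) := by
    intro i a
    simp only [B, eU, Module.Basis.reindex_apply, hint.collectedBasis_coe, Module.Basis.map_apply]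
    exact Submodule.coe_equivMapOfInjective_apply _ _ _ _
  let e : ι × Fin m ≃ Fin n := B.indexEquiv (Pi.basisFun A (Fin n))
  obtain ⟨Q, hQ⟩ := Matrix.exists_units_conj_eq_reindex_toMatrix B e
  refine ⟨s, Q, e, ?_, fun x => ?_⟩
  · -- `s` is irreducible: the transversal `t' = t[i₁ ↦ 1]` has `t' i₁ = 1`
    set t' : ι → G := Function.update t i₁ 1 with ht'def
    have htt' : (fun i => (t' i : G ⧸ N)) = fun i => (t i : G ⧸ N) := by
      funext i
      by_cases hi : i = i₁
      · subst hi
        rw [ht'def, Function.update_self]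
        exact hi₁.symm
      · rw [ht'def, Function.update_of_ne hi]
    have ht' : Function.Surjective fun i => (t' i : G ⧸ N) := htt' ▸ ht.2
    have hWE : ∀ i, U.map (ρ (t' i)) ≤ F i := fun i => by
      by_cases hi : i = i₁
      · subst hi
        rw [ht'def, Function.update_self, map_one, Module.End.one_eq_id, Submodule.map_id, hFi₁]
      · rw [ht'def, Function.update_of_ne hi]
    haveI : W.toRepresentation.IsIrreducible :=
      Representation.isIrreducible_toRepresentation_of_iSupIndep ρ hirr φ.toMonoidHom ht' W hWb
        F hF hWE (Function.update_self i₁ 1 t) hFi₁.le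
    exact Literature.RepresentationTheory.Semisimple.Representation.isIrreducible_of_equiv
      (σU.frameEquiv bU).toRepEquiv.symm
  · -- the conjugacy: `Q r(x) Q⁻¹ = reindex e e [ρ x]_B = reindex e e (Ind(s)(x))`
    have hcol : ∀ (h : H) (b : Fin m),
        ρ (φ.toMonoidHom h) (bU b : Fin n → A) =
          ∑ c, (FramedRep.toMatrixHom s h) c b • (bU c : Fin n → A) := by
      intro h b
      rw [FramedRep.toMatrixHom_apply, hs_coe]
      have h1 : W.toRepresentation h (bU b) =
          ∑ c, (LinearMap.toMatrix bU bU (W.toRepresentation h)) c b • bU c := by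
        conv_lhs => rw [← Matrix.toLin_toMatrix bU bU (W.toRepresentation h)]
        rw [Matrix.toLin_self]
      have h2 : ρ (φ h) (bU b : Fin n → A) = ((W.toRepresentation h (bU b) : U) : Fin n → A) :=
        rfl
      change ρ (φ h) (bU b : Fin n → A) = _
      rw [h2, h1]
      simp
    have hρx : LinearMap.toMatrix' (ρ x) = ((r x : GL (Fin n) A) : Matrix (Fin n) (Fin n) A) := by
      have h1 : ρ x = Matrix.toLin' ((r x : GL (Fin n) A) : Matrix (Fin n) (Fin n) A) :=
        LinearMap.ext fun v => (Matrix.toLin'_apply _ v).symm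
      rw [h1, LinearMap.toMatrix'_toLin']
    rw [← Representation.toMatrix_eq_comp_indMatrix ρ hinj' ht (fun a => (bU a : Fin n → A))
        (FramedRep.toMatrixHom s) hcol B hB x, ← hQ (ρ x), hρx, FramedRep.conj_apply,
      Units.val_mul, Units.val_mul]

end Framed

end Summit.Langlands.Langlands.Theorems

end
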